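import Summits.HubbardSuperconductivity.HubbardSuperconductivity.Theorems.LevyLogBootstrapHalfFilledOrderWindow
import HarnessLib

/-!
# Crux `LevyTransport` (stmt-HubbardSuperconductivity-15049, route `LevyLogBootstrap`):
# normal form, reduction to the hub `HalfFilledOrder`, and the proved window

`LevyTransport` is filed in implication form, `Block2InfDivXXZ → ⟨planar order of every half-filled
sector ground state of H_M(Δ) = xxzHamiltonian 1 (torusGraph 2 M) (-1) Δ, for every Δ ∈ (-1, 0]⟩`,
and its consequent is VERBATIM the hub statement `HalfFilledOrder`
(stmt-HubbardSuperconductivity-0906, shared with the routes `PlaquetteBoson` / `AnisotropyChord`).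
This file records the resulting bookkeeping on the ledger (support lemmas; no statement item is
closed):

* `levyTransport_iff` — `LevyTransport ↔ (Block2InfDivXXZ → HalfFilledOrder)` (definitional);
* `levyTransport_of_halfFilledOrder` — any proof of the hub closes the crux (the antecedent is
  then not needed): `HalfFilledOrder → LevyTransport`;
* `levyTransport_of_deepWindow` — by the Björnberg–Ueltschi window PROVED in the tree in sector form
  (`halfFilledOrder_window`, `Δ ∈ [-0.109, 0]`), the crux already follows from half-filled planar
  order on the DEEP easy-plane interval `Δ ∈ (-1, -0.109)` alone — the genuinely open part, towards
  the Heisenberg point, which is also where the route's anchor `Δ_eff ≈ -0.99` sits;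
* (the consequent of `LevyTransport` holds outright, no infinite divisibility needed, for every
  `Δ ∈ [-0.109, 0]`: this is verbatim the landed `halfFilledOrder_window`, not restated here).

Together with the inputs landed beside this file (`sectorGS_transverse_infraredBound`, input (a);
the nearest-neighbour coherence bound, input (b)) this is the exact state of the crux: what the
log-bootstrap of `Cruxes/LevyTransport/Lines/birth.lean` must still supply is half-filled planar
order on `(-1, -0.109)`, i.e. `stub_logBootstrap` there (inputs (c) pointwise anchor and (d) the
certified budget, which the attached numerics report as failing for 2×2 blocks near `Δ = -1`).

Sources: J. E. Björnberg, D. Ueltschi, arXiv:2204.12896, Thm. 3.2 and p. 11; T. Kennedy, E. H. Lieb,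
B. S. Shastry, PRL 61 (1988) 2582; K. Kubo, T. Kishi, PRL 61 (1988) 2585. No definition is
introduced; sorry-free.
-/

noncomputable section

set_option linter.dupNamespace false

namespace Summit.HubbardSuperconductivity.HubbardSuperconductivity.Theorems.LevyLogBootstrap

open scoped BigOperators Matrix
open Matrix Finset Complex
open Literature.MathematicalPhysics.QuantumLattice Literature.Probability.LatticeModels
open Summit.HubbardSuperconductivity.HubbardSuperconductivity.Theses.LevyLogBootstrap

/-- **Normal form of the crux**: `LevyTransport` is literally the material implication from block
infinite divisibility to the hub `HalfFilledOrder`. [folklore] -/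
theorem levyTransport_iff : LevyTransport ↔ (Block2InfDivXXZ → HalfFilledOrder) := Iff.rfl

/-- **The hub closes the crux**: a proof of `HalfFilledOrder` (stmt-HubbardSuperconductivity-0906)
is a proof of `LevyTransport`, the antecedent being discarded. [folklore] -/
theorem levyTransport_of_halfFilledOrder : HalfFilledOrder → LevyTransport := fun h _ => h

/-- **What is left of the crux after the Björnberg–Ueltschi window**: `LevyTransport` follows from
half-filled planar order on the deep easy-plane interval `Δ ∈ (-1, -0.109)` alone; the window
`[-0.109, 0]` is `halfFilledOrder_window` (PROVED, reflection positivity + Gaussian domination + the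
`T = 0` sum-rule closure in sector form). [cite: BjornbergUeltschi2022, Theorem 3.2 and p. 11] -/
theorem levyTransport_of_deepWindow
    (hdeep : ∀ Δ ∈ Set.Ioo (-1 : ℝ) (-0.109), ∃ c : ℝ, 0 < c ∧ ∃ M₀ : ℕ, ∀ (M : ℕ) [NeZero M],
      Even M → M₀ ≤ M → ∀ (ψ : TensorIndex (TorusSite 2 M) 2 → ℂ),
      ψ ∈ spinZSector (Λ := TorusSite 2 M) 1 0 → star ψ ⬝ᵥ ψ = 1 →
      Matrix.mulVec (xxzHamiltonian 1 (torusGraph 2 M) (-1) Δ) ψ =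
        ((lowestEnergyInSector 1 (xxzHamiltonian 1 (torusGraph 2 M) (-1) Δ) 0 : ℝ) : ℂ) • ψ →
      c * (M : ℝ) ^ 4 ≤ (star ψ ⬝ᵥ Matrix.mulVec
        ((∑ x : TorusSite 2 M, onSite x (spinRaise 1)) *
          (∑ y : TorusSite 2 M, onSite y (spinLower 1))) ψ).re) :
    LevyTransport :=
  levyTransport_of_halfFilledOrder (halfFilledOrder_of_deepWindow hdeep)

end Summit.HubbardSuperconductivity.HubbardSuperconductivity.Theorems.LevyLogBootstrap
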